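import Summits.QuantumFields.YangMills.Theorems.UnitScaleTiltProp7Chart47T3Sym
import Summits.QuantumFields.YangMills.Theorems.UnitScaleTiltProp7SymAvgGLSmallOfRegPr
import Summits.QuantumFields.YangMills.Theorems.UnitScaleTiltProp7TPrintDefs
import HarnessLib

/-!
# `UnitScaleTiltProp7Chart48SymUntwisted` — (48) FOR THE ROUTE'S SYMMETRIC CHART, AND WHAT IT DELIVERS: the chart of record `Chart47T3sym` (untwisted log-chart
# `logChartSym`, linear part `QSym`, [Balaban1985Variational] (47)–(49) for the symmetric (0.4) average) with a right inverse `H` of `QSym` ((46)-sym) LINEARISES THE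
# SYMMETRIC DESCENT: `logChartSym U₀ (A′ − HD(A′)) = QSym U₀ A′` ((48)-sym) — hence the configuration `e^{A}U₀`, `A = A′ − HD(A′)`, with `QSym U₀ A′ = B` satisfies the
# UNTWISTED equation `D̄_GL(e^{A}U₀) = e^{B}·D̄_GL(U₀)`, i.e. for `SU(2)` data and print's datum `iB = log(V·Ū₀⁻¹)`: **`e^{iX}U₀ ∈ 𝔅_k(V)` itself (u = 1)**
# (route `UnitScaleTilt`, crux K1 «MinimiserStabilityRegPr» stmt-QuantumFields-19200, stub `stub_existenceMinimalOrbit` (EX), route (α), (S3)(i)∕(AVG-SYM); def-free, count-neutral)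

Cell `ym3-torus` (HUMAN RULING D-0037, YM ladder rung R3 — YM₃ on T³ is a rung, not d = 4, not a mass gap, not Clay), width seat `ym-ust-20520-w5` (gen 3).

WHY (LOCATED, this seat, FINDING w5-3 Σ-TWIST, HOME `ym-ust-20520-w5/FINDING-w5-3-SIGMA-TWIST.md`).  Print's (48) «Q_j(η(A′ − HD(A′))) = LʲηQ_jA′» is stated for the
DOUBLE-BAR average of [Balaban1985Averaging] (89)–(92) ([Balaban1985BackgroundPropagators] p. 392 «the averaging operation used here is the operation U̿ʲ defined by the formulas
(89)–(92) of [5]»), which is TWISTED by the block frames `\overline{R_{0,·}U₁}` and therefore lands on print's surface Σ_k ((1.37), [Balaban1985RegularSpaces] p. 81 «The set Σ_k is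
not contained in 𝔅_k(𝔅_k, V) because the gauge transformations u do not satisfy the necessary conditions (1.14)»).  The cell's symmetric chart `Prop7SymAvgGL.logChartSym U₀ A c =
log[D̄_GL(e^{A}U₀)(c)·D̄_GL(U₀)(c)⁻¹]` is UNTWISTED; this file records, as theorems about the EXISTING definitions, what (48) then says and which surface the chart reaches:
the fibre `𝔅_k(V)` itself — to be read next to `Prop7Chart5T3OfEq137cov.fibreClause_of_eq137cov` (the displayed (CH5EL) fibre clause ⟺ the TWISTED (1.37)^cov).

WHAT IS PROVED (sorry-free, no definition; `D := B11Prop3Model.Dfix (CmapSym U₀) H C₂`):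
* §1 ★**`logChartSym_eq_QSym_of_chart47sym`** — (48)-sym: `Chart47T3sym F n K h C₂ ε U₀ H` ∧ `QSym U₀ ∘ H = id` ⟹ `logChartSym U₀ (A′ − H(DA′)) = QSym U₀ A′` on `‖A′‖ < ε`
  (three lines of algebra: (49)-sym says `logChartSym A − QSym A = DA′`, and `QSym A = QSym A′ − DA′`).
* §2 **`descendToGL_eq_exp_mul_of_logChartSym_eq`** — exponentiating the log-chart inside the `log` window: `logChartSym U₀ A = Y` ∧ `‖D̄(e^{A}U₀)(c)D̄(U₀)(c)⁻¹ − 1‖ < 1` ⟹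
  `D̄_GL(e^{A}U₀)(c) = e^{Y(c)}·D̄_GL(U₀)(c)` (`MatrixLog.exp_mlog`).
* §3 AT `SU(2)` DATA: `unitsField_toUField_emb15_expHermField` (`(e^{iX}U₀)♭ = e^{iX}·U₀♭`), ★**`mem_fibre_of_logChartSym_eq_mlog`** — for `U₀`, `e^{iX}U₀` printed-regular (so the
  route's descent IS the complexified one, `Prop7SymAvgGLSmallOfRegPr.unitsField_toUField_descendTo_of_regPr`) and `logChartSym U₀ (iX) = log(V·Ū₀⁻¹)` bondwise inside the windows:
  **`emb15 U₀ (expHermField X) ∈ fibre F ℰp n K h V`**; ★**`mem_fibre_of_logChartSym_eq_zero`** — the EX-stub case `U₀ ∈ 𝔅_k(V)` (B = 0): `logChartSym U₀ (iX) = 0 ⟹ e^{iX}U₀ ∈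
  𝔅_k(V)` (converse of `Prop7SymAvgGLSmallOfRegPr.logChartSym_eq_zero_of_mem_fibre`).
* §4 ★★**`mem_fibre_of_chart47sym`** — §1 ∘ §3: the symmetric chart with `QSym∘H = id`, a chart parameter `A′` (‖A′‖ < ε) whose linear average is print's datum,
  `QSym U₀ A′ c = log(V(c)·Ū₀(c)⁻¹)`, and whose image `A′ − H(DA′) = iX` is `i`·(Hermitian traceless), puts `e^{iX}U₀` IN THE FIBRE OF `V` (not on Σ_k).
* §5 **`gaugeAct_descTransf_eq_of_mem_of_gaugeAct_mem`** — `W ∈ 𝔅_k(V)` ∧ `Wᵘ ∈ 𝔅_k(V)` ⟹ `u↓ • V = V`: the untwisted (§3–§4) and twisted ((CH5EL), p605215) fibre clauses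
  hold together only on the stabiliser of `V` (for the restricted axial `u`: `wrec • V = V`).
HONEST FRAMING.  Bookkeeping over landed letters; the windows (printed regularity of `U₀` and of `e^{iX}U₀`, the two `log` windows) are displayed hypotheses; nothing of print is
asserted; no claim that this is the surface the EX knit needs — that is exactly the Σ-TWIST question put to the owner.  `--supports stmt-QuantumFields-19200 --as helper`.

References: T. Bałaban, CMP 102 (1985) 277–309 [Balaban1985Variational] ((44)–(49) p.285, (51) p.286, Prop. 3 p.289, (112) p.294); CMP 99 (1985) 75–102
[Balaban1985RegularSpaces] ((1.28)–(1.31) pp.81–82, (1.37) p.82); CMP 99 (1985) 389–434 [Balaban1985BackgroundPropagators] (p.392, (3.13)–(3.15) p.393); CMP 98 (1985)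
17–51 [Balaban1985Averaging] ((89)–(92) p.31); CMP 109 (1987) 249–301 [Balaban1987RG1] ((0.4) p.253).
-/

set_option autoImplicit false

noncomputable section

open scoped Matrix.Norms.L2Operator

namespace Summit.QuantumFields.YangMills.Theorems.Prop7Chart48SymUntwisted

open NormedSpace
open Literature.MathematicalPhysics.QuantumFieldTheory.Balaban1983to89
open Literature.MathematicalPhysics.QuantumFieldTheory.Balaban1983to89.T3ContinuumYM3Torus
open T3PrintedRegularMinimiser (RegPr)
open T3ConstrainedMinimiser (fibre)
open T3TiltDescent (descendTo)
open T3UnitLawDensityEML (ℰp)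
open T3SectALandauChart (bgUnits emb15)
open B7Prop1Explicit (expUnit val_expUnit)
open B10Eq27TorusAxialLog (unitsField toUField val_unitsField)
open B11Prop3Model (Dfix)
open MatrixLog (mlog mlog_one exp_mlog)
open Summit.QuantumFields.YangMills.Theorems.Prop7TPrint (expHermField expHermField_apply coe_expHerm)
open Summit.QuantumFields.YangMills.Theorems.Prop7SymAvgGL (descendToGL logChartSym QSym CmapSym Chart47T3sym)
open Summit.QuantumFields.YangMills.Theorems.Prop7SymAvgGLSmallOfRegPr (unitsField_toUField_descendTo_of_regPr bgUnits_eq)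

variable (F : T3Family) {n K : ℕ} (h : n ≤ K)

/-! ## §1 (48) for the symmetric chart -/

/-- ★ **(48)-sym — THE SYMMETRIC CHART LINEARISES THE SYMMETRIC DESCENT**: if `Chart47T3sym F n K h C₂ ε U₀ H` ((49)-sym on the `ε`-ball) and `H` is a right inverse of
`QSym U₀` ((46)-sym, `QSym U₀ (HX) = X`), then for every chart parameter `A′` with `‖A′‖ < ε` the log-chart of `A := A′ − H(DA′)` is LINEAR in `A′`:
`logChartSym U₀ A = QSym U₀ A′` — print's «Q_j(η(A′ − HD(A′))) = LʲηQ_jA′ (48)» for the route's (untwisted) symmetric average.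
[cite: Balaban1985Variational, (47)–(49) p.285, Prop. 3 p.289] -/
theorem logChartSym_eq_QSym_of_chart47sym {C₂ ε : ℝ} {U₀ : GaugeField (F.P K) 0 (Matrix.specialUnitaryGroup (Fin 2) ℂ)}
    {H : (PBond (F.P n) 0 → Matrix (Fin 2) (Fin 2) ℂ) →ₗ[ℂ] (PBond (F.P K) 0 → Matrix (Fin 2) (Fin 2) ℂ)}
    (h47 : Chart47T3sym F n K h C₂ ε U₀ H) (hQH : ∀ X, QSym F n K h U₀ (H X) = X)
    (A' : PBond (F.P K) 0 → Matrix (Fin 2) (Fin 2) ℂ) (hA' : ‖A'‖ < ε) :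
    logChartSym F n K h U₀ (A' - H (Dfix (CmapSym F n K h U₀) H C₂ A')) = QSym F n K h U₀ A' := by
  have h49 : logChartSym F n K h U₀ (A' - H (Dfix (CmapSym F n K h U₀) H C₂ A'))
      - QSym F n K h U₀ (A' - H (Dfix (CmapSym F n K h U₀) H C₂ A')) = Dfix (CmapSym F n K h U₀) H C₂ A' := h47.1 A' hA'
  rw [map_sub, hQH, sub_eq_iff_eq_add] at h49
  rw [h49]
  abel

/-! ## §2 Exponentiating the log-chart -/

/-- **EXPONENTIATING THE LOG-CHART** inside the `log` window: `logChartSym U₀ A = Y` and `‖D̄_GL(e^{A}U₀)(c)·D̄_GL(U₀)(c)⁻¹ − 1‖ < 1` give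
`D̄_GL(e^{A}U₀)(c) = e^{Y(c)}·D̄_GL(U₀)(c)` (`exp ∘ log = id` on the window, `MatrixLog.exp_mlog`). [cite: Balaban1985Averaging, (21)–(27) p.22; Balaban1985Variational, (44) p.285] -/
theorem descendToGL_eq_exp_mul_of_logChartSym_eq (U₀ : GaugeField (F.P K) 0 (Matrix.specialUnitaryGroup (Fin 2) ℂ))
    (A : PBond (F.P K) 0 → Matrix (Fin 2) (Fin 2) ℂ) (Y : PBond (F.P n) 0 → Matrix (Fin 2) (Fin 2) ℂ) (hlog : logChartSym F n K h U₀ A = Y) (c : PBond (F.P n) 0)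
    (hwin : ‖((descendToGL F n K h (fun b => expUnit (A b) * bgUnits F K U₀ b) c : (Matrix (Fin 2) (Fin 2) ℂ)ˣ) : Matrix (Fin 2) (Fin 2) ℂ) *
        (((descendToGL F n K h (bgUnits F K U₀) c)⁻¹ : (Matrix (Fin 2) (Fin 2) ℂ)ˣ) : Matrix (Fin 2) (Fin 2) ℂ) - 1‖ < 1) :
    ((descendToGL F n K h (fun b => expUnit (A b) * bgUnits F K U₀ b) c : (Matrix (Fin 2) (Fin 2) ℂ)ˣ) : Matrix (Fin 2) (Fin 2) ℂ)
      = exp (Y c) * ((descendToGL F n K h (bgUnits F K U₀) c : (Matrix (Fin 2) (Fin 2) ℂ)ˣ) : Matrix (Fin 2) (Fin 2) ℂ) := by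
  have hc : mlog (((descendToGL F n K h (fun b => expUnit (A b) * bgUnits F K U₀ b) c : (Matrix (Fin 2) (Fin 2) ℂ)ˣ) : Matrix (Fin 2) (Fin 2) ℂ) *
      (((descendToGL F n K h (bgUnits F K U₀) c)⁻¹ : (Matrix (Fin 2) (Fin 2) ℂ)ˣ) : Matrix (Fin 2) (Fin 2) ℂ)) = Y c := by
    rw [← hlog]; rfl
  have hexp := exp_mlog hwin
  rw [hc] at hexp
  -- `e^{Y c} = P·Q⁻¹`, hence `P = e^{Y c}·Q`
  rw [hexp, mul_assoc, Units.inv_mul, mul_one]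

/-! ## §3 At `SU(2)` data: the untwisted fibre membership -/

/-- `(e^{iX}U₀)♭ = e^{iX}·U₀♭` bondwise in `(M₂)ˣ`: the configuration `emb15 U₀ (expHermField X)` of (15)∕(112) read in units is the chart's `fun b => expUnit (iX b) * bgUnits U₀ b`
(`X` bondwise Hermitian traceless). [cite: Balaban1985Variational, (15) p.280, (112) p.294] -/
theorem unitsField_toUField_emb15_expHermField (U₀ : GaugeField (F.P K) 0 (Matrix.specialUnitaryGroup (Fin 2) ℂ))
    (X : PBond (F.P K) 0 → Matrix (Fin 2) (Fin 2) ℂ) (hX : ∀ b : PBond (F.P K) 0, (X b).IsHermitian ∧ Matrix.trace (X b) = 0) :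
    unitsField (toUField (emb15 U₀ (expHermField X))) = fun b => expUnit (Complex.I • X b) * bgUnits F K U₀ b := by
  funext b
  apply Units.ext
  rw [val_unitsField, Units.val_mul, val_expUnit, bgUnits_eq, val_unitsField, ← coe_expHerm (hX b), ← expHermField_apply]
  rfl

/-- ★ **THE UNTWISTED FIBRE MEMBERSHIP FROM THE LOG-CHART EQUATION**: let `U₀` and `e^{iX}U₀` be printed-regular (`RegPr`, `10⁷L³·max(ε₀,ε₁) ≤ 1` — so the route's descent of
both IS the complexified one), `X` bondwise Hermitian traceless, and let the symmetric log-chart of `iX` equal print's datum `log(V·Ū₀⁻¹)` bondwise on the comparison lattice, inside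
the two `log` windows; then **`e^{iX}U₀ ∈ 𝔅_k(V)`** (`descendTo F ℰp n K h (emb15 U₀ (expHermField X)) = V`) — the fibre itself, with NO gauge transformation.
[cite: Balaban1985Variational, (20) p.281, (44) p.285, (112) p.294; Balaban1985RegularSpaces, (1.28) p.81, (1.31) p.82] -/
theorem mem_fibre_of_logChartSym_eq_mlog {ε₀ ε₁ : ℝ} (hε₀ : 0 < ε₀) (hε₀' : 10 ^ 7 * (F.L : ℝ) ^ 3 * ε₀ ≤ 1)
    (hε₁ : 0 < ε₁) (hε₁' : 10 ^ 7 * (F.L : ℝ) ^ 3 * ε₁ ≤ 1)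
    {U₀ : GaugeField (F.P K) 0 (Matrix.specialUnitaryGroup (Fin 2) ℂ)} (hU₀ : RegPr F n K ε₀ U₀)
    {X : PBond (F.P K) 0 → Matrix (Fin 2) (Fin 2) ℂ} (hX : ∀ b : PBond (F.P K) 0, (X b).IsHermitian ∧ Matrix.trace (X b) = 0)
    (hU₁ : RegPr F n K ε₁ (emb15 U₀ (expHermField X)))
    (V : GaugeField (F.P n) 0 (Matrix.specialUnitaryGroup (Fin 2) ℂ))
    (hlog : logChartSym F n K h U₀ (fun b => Complex.I • X b)
      = fun c => mlog (((V c : Matrix.specialUnitaryGroup (Fin 2) ℂ) : Matrix (Fin 2) (Fin 2) ℂ)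
          * (((descendTo F ℰp n K h U₀ c : Matrix.specialUnitaryGroup (Fin 2) ℂ) : Matrix (Fin 2) (Fin 2) ℂ))⁻¹))
    (hwin : ∀ c : PBond (F.P n) 0,
      ‖((descendToGL F n K h (fun b => expUnit (Complex.I • X b) * bgUnits F K U₀ b) c : (Matrix (Fin 2) (Fin 2) ℂ)ˣ) : Matrix (Fin 2) (Fin 2) ℂ) *
        (((descendToGL F n K h (bgUnits F K U₀) c)⁻¹ : (Matrix (Fin 2) (Fin 2) ℂ)ˣ) : Matrix (Fin 2) (Fin 2) ℂ) - 1‖ < 1)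
    (hwinV : ∀ c : PBond (F.P n) 0,
      ‖((V c : Matrix.specialUnitaryGroup (Fin 2) ℂ) : Matrix (Fin 2) (Fin 2) ℂ)
          * (((descendTo F ℰp n K h U₀ c : Matrix.specialUnitaryGroup (Fin 2) ℂ) : Matrix (Fin 2) (Fin 2) ℂ))⁻¹ - 1‖ < 1) :
    emb15 U₀ (expHermField X) ∈ fibre F ℰp n K h V := by
  -- the route's descents ARE the complexified ones (printed regularity)
  have hD₀ : unitsField (toUField (descendTo F ℰp n K h U₀)) = descendToGL F n K h (bgUnits F K U₀) := by
    rw [bgUnits_eq]; exact unitsField_toUField_descendTo_of_regPr F h hε₀ hε₀' hU₀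
  have hD₁ : unitsField (toUField (descendTo F ℰp n K h (emb15 U₀ (expHermField X))))
      = descendToGL F n K h (fun b => expUnit (Complex.I • X b) * bgUnits F K U₀ b) := by
    rw [← unitsField_toUField_emb15_expHermField F U₀ X hX]
    exact unitsField_toUField_descendTo_of_regPr F h hε₁ hε₁' hU₁
  show descendTo F ℰp n K h (emb15 U₀ (expHermField X)) = V
  funext c
  apply Subtype.ext
  have hc := descendToGL_eq_exp_mul_of_logChartSym_eq F h U₀ (fun b => Complex.I • X b) _ hlog c (hwin c)
  -- read `hc` back on the route's side
  have hval : (((descendTo F ℰp n K h (emb15 U₀ (expHermField X)) c : Matrix.specialUnitaryGroup (Fin 2) ℂ)) : Matrix (Fin 2) (Fin 2) ℂ)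
      = ((descendToGL F n K h (fun b => expUnit (Complex.I • X b) * bgUnits F K U₀ b) c : (Matrix (Fin 2) (Fin 2) ℂ)ˣ) : Matrix (Fin 2) (Fin 2) ℂ) := by
    rw [← hD₁, val_unitsField]; rfl
  have hval₀ : ((descendToGL F n K h (bgUnits F K U₀) c : (Matrix (Fin 2) (Fin 2) ℂ)ˣ) : Matrix (Fin 2) (Fin 2) ℂ)
      = (((descendTo F ℰp n K h U₀ c : Matrix.specialUnitaryGroup (Fin 2) ℂ)) : Matrix (Fin 2) (Fin 2) ℂ) := by
    rw [← hD₀, val_unitsField]; rfl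
  rw [hval, hc, exp_mlog (hwinV c), hval₀, mul_assoc]
  -- `V(c)·Ū₀(c)⁻¹·Ū₀(c) = V(c)` (the SU(2) matrix `Ū₀(c)` is invertible)
  have hdet : IsUnit (((descendTo F ℰp n K h U₀ c : Matrix.specialUnitaryGroup (Fin 2) ℂ)) : Matrix (Fin 2) (Fin 2) ℂ).det := by
    rw [(Matrix.mem_specialUnitaryGroup_iff.1 (descendTo F ℰp n K h U₀ c).2).2]; exact isUnit_one
  rw [Matrix.nonsing_inv_mul _ hdet, mul_one]

/-- ★ **THE EX-STUB CASE `U₀ ∈ 𝔅_k(V)` (B = 0)**: if the background lies in the fibre of `V` (a HYPOTHESIS of `stub_existenceMinimalOrbit` ∕ `stubEX_of_displayedRows`), `U₀` and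
`e^{iX}U₀` are printed-regular, and the symmetric log-chart of `iX` VANISHES (inside the window), then `e^{iX}U₀ ∈ 𝔅_k(V)` — the converse of
`Prop7SymAvgGLSmallOfRegPr.logChartSym_eq_zero_of_mem_fibre`. [cite: Balaban1985Variational, (3) p.278, (20) p.281, (44) p.285; Balaban1985RegularSpaces, (1.13) p.78] -/
theorem mem_fibre_of_logChartSym_eq_zero {ε₀ ε₁ : ℝ} (hε₀ : 0 < ε₀) (hε₀' : 10 ^ 7 * (F.L : ℝ) ^ 3 * ε₀ ≤ 1)
    (hε₁ : 0 < ε₁) (hε₁' : 10 ^ 7 * (F.L : ℝ) ^ 3 * ε₁ ≤ 1)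
    {V : GaugeField (F.P n) 0 (Matrix.specialUnitaryGroup (Fin 2) ℂ)}
    {U₀ : GaugeField (F.P K) 0 (Matrix.specialUnitaryGroup (Fin 2) ℂ)} (hU₀V : U₀ ∈ fibre F ℰp n K h V) (hU₀ : RegPr F n K ε₀ U₀)
    {X : PBond (F.P K) 0 → Matrix (Fin 2) (Fin 2) ℂ} (hX : ∀ b : PBond (F.P K) 0, (X b).IsHermitian ∧ Matrix.trace (X b) = 0)
    (hU₁ : RegPr F n K ε₁ (emb15 U₀ (expHermField X)))
    (hlog : logChartSym F n K h U₀ (fun b => Complex.I • X b) = 0)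
    (hwin : ∀ c : PBond (F.P n) 0,
      ‖((descendToGL F n K h (fun b => expUnit (Complex.I • X b) * bgUnits F K U₀ b) c : (Matrix (Fin 2) (Fin 2) ℂ)ˣ) : Matrix (Fin 2) (Fin 2) ℂ) *
        (((descendToGL F n K h (bgUnits F K U₀) c)⁻¹ : (Matrix (Fin 2) (Fin 2) ℂ)ˣ) : Matrix (Fin 2) (Fin 2) ℂ) - 1‖ < 1) :
    emb15 U₀ (expHermField X) ∈ fibre F ℰp n K h V := by
  have hV : descendTo F ℰp n K h U₀ = V := hU₀V
  have hdet : ∀ c : PBond (F.P n) 0, IsUnit (((V c : Matrix.specialUnitaryGroup (Fin 2) ℂ)) : Matrix (Fin 2) (Fin 2) ℂ).det := fun c => by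
    rw [(Matrix.mem_specialUnitaryGroup_iff.1 (V c).2).2]; exact isUnit_one
  refine mem_fibre_of_logChartSym_eq_mlog F h hε₀ hε₀' hε₁ hε₁' hU₀ hX hU₁ V ?_ hwin fun c => ?_
  · rw [hlog, hV]
    funext c
    rw [Matrix.mul_nonsing_inv _ (hdet c), mlog_one]
    rfl
  · rw [hV, Matrix.mul_nonsing_inv _ (hdet c), sub_self, norm_zero]
    exact one_pos

/-! ## §4 What the symmetric chart delivers: the fibre, not Σ_k -/

/-- ★★ **THE SYMMETRIC CHART OF RECORD PUTS `e^{iX}U₀` IN THE FIBRE OF `V` (u = 1), NOT ON Σ_k**: `Chart47T3sym F n K h C₂ ε U₀ H` with `QSym U₀ ∘ H = id` ((46)-sym), a chart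
parameter `A′` (‖A′‖ < ε) whose symmetric linear average is print's datum, `QSym U₀ A′ = log(V·Ū₀⁻¹)` bondwise ((20) in the form «Q(U₀)(ηA′) = B», B = `Bsym` of RULING (B20) up to
the factor `i`), and whose image `A′ − H(DA′) = iX` has `X` Hermitian traceless, inside the regularity and `log` windows ⟹ **`emb15 U₀ (expHermField X) ∈ fibre F ℰp n K h V`** —
by §1 ((48)-sym) and §3.  Compare `Prop7Chart5T3OfEq137cov.fibreClause_of_eq137cov`: the displayed (CH5EL) clause «every RESTRICTED axial `(e^{iX}U₀)ᵘ ∈ fibre V`» is the TWISTED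
equation `D̄(e^{iX}U₀) = wrec • V` — [Balaban1985RegularSpaces] p. 81 «Σ_k is not contained in 𝔅_k(𝔅_k, V)».
[cite: Balaban1985Variational, (47)–(49) p.285, Prop. 3 p.289, (20) p.281, (112) p.294; Balaban1985RegularSpaces, p.81, (1.31) p.82] -/
theorem mem_fibre_of_chart47sym {C₂ ε ε₀ ε₁ : ℝ} (hε₀ : 0 < ε₀) (hε₀' : 10 ^ 7 * (F.L : ℝ) ^ 3 * ε₀ ≤ 1)
    (hε₁ : 0 < ε₁) (hε₁' : 10 ^ 7 * (F.L : ℝ) ^ 3 * ε₁ ≤ 1)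
    {U₀ : GaugeField (F.P K) 0 (Matrix.specialUnitaryGroup (Fin 2) ℂ)} (hU₀ : RegPr F n K ε₀ U₀)
    {H : (PBond (F.P n) 0 → Matrix (Fin 2) (Fin 2) ℂ) →ₗ[ℂ] (PBond (F.P K) 0 → Matrix (Fin 2) (Fin 2) ℂ)}
    (h47 : Chart47T3sym F n K h C₂ ε U₀ H) (hQH : ∀ Y, QSym F n K h U₀ (H Y) = Y)
    (V : GaugeField (F.P n) 0 (Matrix.specialUnitaryGroup (Fin 2) ℂ))
    (A' : PBond (F.P K) 0 → Matrix (Fin 2) (Fin 2) ℂ) (hA' : ‖A'‖ < ε)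
    (hQA' : QSym F n K h U₀ A'
      = fun c => mlog (((V c : Matrix.specialUnitaryGroup (Fin 2) ℂ) : Matrix (Fin 2) (Fin 2) ℂ)
          * (((descendTo F ℰp n K h U₀ c : Matrix.specialUnitaryGroup (Fin 2) ℂ) : Matrix (Fin 2) (Fin 2) ℂ))⁻¹))
    {X : PBond (F.P K) 0 → Matrix (Fin 2) (Fin 2) ℂ} (hX : ∀ b : PBond (F.P K) 0, (X b).IsHermitian ∧ Matrix.trace (X b) = 0)
    (hAX : A' - H (Dfix (CmapSym F n K h U₀) H C₂ A') = fun b => Complex.I • X b)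
    (hU₁ : RegPr F n K ε₁ (emb15 U₀ (expHermField X)))
    (hwin : ∀ c : PBond (F.P n) 0,
      ‖((descendToGL F n K h (fun b => expUnit (Complex.I • X b) * bgUnits F K U₀ b) c : (Matrix (Fin 2) (Fin 2) ℂ)ˣ) : Matrix (Fin 2) (Fin 2) ℂ) *
        (((descendToGL F n K h (bgUnits F K U₀) c)⁻¹ : (Matrix (Fin 2) (Fin 2) ℂ)ˣ) : Matrix (Fin 2) (Fin 2) ℂ) - 1‖ < 1)
    (hwinV : ∀ c : PBond (F.P n) 0,
      ‖((V c : Matrix.specialUnitaryGroup (Fin 2) ℂ) : Matrix (Fin 2) (Fin 2) ℂ)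
          * (((descendTo F ℰp n K h U₀ c : Matrix.specialUnitaryGroup (Fin 2) ℂ) : Matrix (Fin 2) (Fin 2) ℂ))⁻¹ - 1‖ < 1) :
    emb15 U₀ (expHermField X) ∈ fibre F ℰp n K h V := by
  have h48 := logChartSym_eq_QSym_of_chart47sym F h h47 hQH A' hA'
  rw [hAX, hQA'] at h48
  exact mem_fibre_of_logChartSym_eq_mlog F h hε₀ hε₀' hε₁ hε₁' hU₀ hX hU₁ V h48 hwin hwinV

/-! ## §5 The two surfaces meet only on the stabiliser of `V` -/

/-- **𝔅_k(V) AND ITS Σ_k-TRANSLATE MEET ONLY ON THE STABILISER**: if a configuration `W` lies in the fibre of `V` AND some gauge translate `Wᵘ` lies there too, then the descended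
transformation `u↓` STABILISES `V` (`u↓ • V = V`; covariance [Balaban1985Averaging] (11) `D̄(Wᵘ) = u↓ • D̄W`).  With `W = e^{iX}U₀` from §3∕§4 and `u` the restricted axial
representative of (CH5EL) (`u↓ = wrec⁻¹`, `Prop7ChartSigmaT3.toUnits_descTransf_eq_wrec_inv`), this is the condition «`wrec • V = V`» of FINDING w5-3 §2(a): the untwisted and the
twisted fibre clauses hold together only when the block frame of `e^{iX}` fixes `V`. [cite: Balaban1985Averaging, (11) p.19; Balaban1985RegularSpaces, p.81, (1.30) p.81] -/
theorem gaugeAct_descTransf_eq_of_mem_of_gaugeAct_mem {V : GaugeField (F.P n) 0 (Matrix.specialUnitaryGroup (Fin 2) ℂ)}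
    {W : GaugeField (F.P K) 0 (Matrix.specialUnitaryGroup (Fin 2) ℂ)} (hW : W ∈ fibre F ℰp n K h V)
    (u : GaugeTransf (F.P K) 0 (Matrix.specialUnitaryGroup (Fin 2) ℂ)) (hWu : GaugeField.gaugeAct u W ∈ fibre F ℰp n K h V) :
    GaugeField.gaugeAct (T3PrintedRegularOrbits.descTransf F n K h u) V = V := by
  have hW' : descendTo F ℰp n K h W = V := hW
  have hWu' : descendTo F ℰp n K h (GaugeField.gaugeAct u W) = V := hWu
  rw [T3PrintedRegularOrbits.descendTo_gaugeAct, hW'] at hWu'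
  exact hWu'

end Summit.QuantumFields.YangMills.Theorems.Prop7Chart48SymUntwisted

end
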